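import Mathlib
import HarnessLib
import Summits.RiemannHypothesis.RiemannHypothesis.Theses.UniversalFactor
import Literature.NumberTheory.LFunctions.DeBruijnHDiv
import Literature.NumberTheory.LFunctions.ZetaZeros
import Literature.NumberTheory.LFunctions.RiemannSiegel

/-!
Sketch for crux-ideate stmt-RiemannHypothesis-2576 (NarrowKernelNoGo), ideator 2.
Card `laguerre-count-transfer-energy`: first lemmas L1–L3 + the logical skeleton, statements only.
-/

noncomputable section

open MeasureTheory Set Filter

namespace Summit.RiemannHypothesis.RiemannHypothesis.Cruxes.NarrowKernelNoGo.Sketch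

open Literature.NumberTheory.LFunctions

/-- The Laplace(a)-smoothed transform `F_a = deBruijnHDiv (1 + u²/a²)` (the crux's function). -/
def F (a : ℝ) : ℂ → ℂ := deBruijnHDiv fun u : ℝ => 1 + u ^ 2 / a ^ 2

/-- L1 — LAGUERRE COUNT TRANSFER (the lever's first checkable statement).
If `F_a` has only real zeros then every open real interval on which `F_a` does not vanish carries
at most two zeta ordinates (counted with multiplicity; `H_0(2γ) = 0 ↔ ξ(1/2+iγ) = 0`).
Proof sketch: LP(F_a) ⇒ RH (LaguerreLift) and `H_0 = (1 − D/a)(1 + D/a) F_a`; each Laguerre factor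
`(1 ± D/a) G = ± a⁻¹ e^{∓ax} (e^{±ax} G)'` changes the zero count of any interval by at most one
(Rolle + strict monotonicity of `G'/G` on gaps, `LaguerrePolya.exists_logDeriv_eq_sum_add_small_im`). -/
def L1_countTransfer : Prop :=
  ∀ a : ℝ, 0 < a → HasOnlyRealZeros (F a) →
    ∀ t₁ t₂ : ℝ, (∀ x : ℝ, 2 * t₁ < x → x < 2 * t₂ → F a (x : ℂ) ≠ 0) →
      ∀ s₁ s₂ : ℝ, t₁ ≤ s₁ → s₂ < t₂ → (zetaZeroCount s₂ : ℤ) - (zetaZeroCount s₁ : ℤ) ≤ 2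

/-- The normalised real trace `R_a(t) = F_a(2t) · t^{-7/4} e^{πt/4}` (= const · (Z ⋆ k_a)(t)(1+O(1/t)),
`k_a(v) = e^{−πv/4 − 2a|v|}`, integrable iff `a > π/8`). -/
def R (a : ℝ) (t : ℝ) : ℝ :=
  (F a ((2 * t : ℝ) : ℂ)).re * (t ^ (-(7:ℝ)/4) * Real.exp (Real.pi * t / 4))

/-- L2 — LOG-FREE ENERGY BUDGET (mean values of the Lorentz-filtered Hardy function):
crude two-sided bounds of order `T` (no `log T`!) for `∫_T^{2T} R_a²` from below and
`∫_{T-1}^{2T+1} R_a'²` from above, for every `a > π/8`. Heuristic constants: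
`C₀(a) = 4π∫k_a²`, `C₂(a)/C₀(a) = 4a² + O(1)`. Inputs: AFE `Z = z₁ + z̄₁ + e`
(`TwistedMoment.norm_hardyZErr_le`, `integral_norm_sq_hardyZErr_le`) + Montgomery–Vaughan
(`DirichletMVT.meanSquare_le_sharp`). -/
def L2_energyBudget : Prop :=
  ∀ a : ℝ, Real.pi / 8 < a → ∃ c C T₁ : ℝ, 0 < c ∧ 0 < C ∧ ∀ T : ℝ, T₁ ≤ T →
    c * T ≤ ∫ t in T..(2 * T), R a t ^ 2 ∧
    ∫ t in (T - 1)..(2 * T + 1), deriv (R a) t ^ 2 ≤ C * T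

/-- L3 — ZETA INPUT (RH-conditional lower half of Goldston–Gonek / Balazard–de Roton Prop. 16,
the minorant twin of the tree's `zetaZeroCount_short_interval_GG_of_RH`; or Littlewood's
unconditional gap theorem, Titchmarsh Thm 9.12): under RH every window of fixed length
eventually holds at least three zeros. -/
def L3_threeZerosEverywhere : Prop :=
  RiemannHypothesis → ∀ h : ℝ, 0 < h → ∃ T₂ : ℝ, ∀ t : ℝ, T₂ ≤ t →
    (3 : ℤ) ≤ (zetaZeroCount (t + h / 2) : ℤ) - (zetaZeroCount (t - h) : ℤ)


/-- L4 — CURVATURE IDENTITY, usable corollary (closing B of the card): under LP(F_a), for real `x` with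
`F_a(x) ≠ 0` and ANY zero `y` of `F_a`,
`a² H_0(x)/F_a(x) ≥ a² − (F_a'(x)/F_a(x))² + 1/(x−y)²`
(from `(log F_a)'' = −Σ_y (x−y)^{-2}` for the even genus-≤1 LP function `F_a` and the ODE `F_a'' = a²(F_a − H_0)`,
`deBruijnHDiv_laplace_sub_deriv_deriv`). All quantities are real on `ℝ` (`deBruijnHDiv_ofReal_im`). -/
def L4_curvature : Prop :=
  ∀ a : ℝ, 0 < a → HasOnlyRealZeros (F a) → ∀ x : ℝ, F a (x : ℂ) ≠ 0 → ∀ y : ℂ, F a y = 0 →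
    a ^ 2 - (deriv (fun u : ℝ => (F a (u : ℂ)).re) x / (F a (x : ℂ)).re) ^ 2 + 1 / (x - y.re) ^ 2
      ≤ a ^ 2 * (deBruijnH 0 (x : ℂ)).re / (F a (x : ℂ)).re

/-- The crux, restated (`Iff.rfl` with the route decl via `deBruijnHDiv_laplace_eq`). -/
example : Theses.UniversalFactor.NarrowKernelNoGo ↔
    ∀ a : ℝ, 32 ≤ a → ¬ HasOnlyRealZeros (F a) := Iff.rfl

/-- The stronger form the lever actually proves (whole narrow+medium Laplace ray). -/
def LaplaceRayNoGo : Prop := ∀ a : ℝ, Real.pi / 8 < a → ¬ HasOnlyRealZeros (F a)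

example (h : LaplaceRayNoGo) : Theses.UniversalFactor.NarrowKernelNoGo := fun a ha =>
  h a (lt_of_lt_of_le (by have := Real.pi_lt_four; linarith) ha)

example (h : LaplaceRayNoGo) : ∀ a : ℝ, Real.pi / 8 < a → a ≤ 32 →
    ¬ HasOnlyRealZeros (F a) := fun a ha _ => h a ha

/-- ASSEMBLY SHAPE (L²-pigeonhole): from L2 pick `h < √(c/2C)`; averaging over `[T,2T]` gives
`t₀` with `R(t₀)² > h ∫_{t₀-h}^{t₀+h} R'²`, whence (Cauchy–Schwarz) `R ≠ 0` on `(t₀-h, t₀+h)`,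
i.e. `F_a ≠ 0` on `(2t₀-2h, 2t₀+2h)`; L1 then allows ≤ 2 ordinates in `(t₀-h, t₀+h)`, while
LP(F_a) ⇒ RH (LaguerreLift) and L3 give ≥ 3. Typed target: -/
def AssemblyShape : Prop :=
  L1_countTransfer → L2_energyBudget → L3_threeZerosEverywhere →
    Theses.UniversalFactor.LaguerreLift → LaplaceRayNoGo

end Summit.RiemannHypothesis.RiemannHypothesis.Cruxes.NarrowKernelNoGo.Sketch
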